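import Summits.Langlands.Langlands.Theses.NonParallelVoid
import Literature.NumberTheory.GaloisRepresentations.AbsIrreducibleIndexTwo
import Literature.RepresentationTheory.Semisimple.IrreducibleOfCharpoly

/-!
# Disproof of `TwistedInductionParallel` — findings (cdisprove seat, cycle 1, 2026-08-17)

Crux `stmt-Langlands-17000` = `Summit.Langlands.Langlands.Theses.NonParallelVoid.TwistedInductionParallel`
(F imaginary quadratic, `p ≥ 11` split in F, `ρ : Γ_F → GL₂(ℚ̄_p)` irreducible, a.e. unramified,
de Rham at both `v ∣ p` with two distinct labelled Hodge–Tate weights at every label, crystalline,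
`ρ̄|Γ_(F(ζ_p))` absolutely irreducible, gap sum even ⟹ one common gap).

## Verdict of this cycle: NO KILL.  Why it resists

* The statement is FAITHFULLY typed (§0): the period ring of the pinned datum is the CONSTRUCTED
  `B_dR(F_v)` (`fontainePstAdicCompletion_𝔅_eq_bdRPeriodRingData`, unconditional), so
  `labelledHodgeTateWeightsAt` are genuine `B_dR`-weights; `PadicAlgCl p` is Mathlib's normed `ℚ̄_p`
  (continuity is not vacuous); `residualRep`/`IsResiduallyAbsIrreducible` are lattice-and-Brauer–Nesbitt
  faithful; `CyclotomicField p F`, `restrictField`, `toLocal` are along the fixed `absGaloisRestrict`;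
  `Algebra.IsQuadraticExtension ℚ F ∧ IsTotallyComplex F` = imaginary quadratic; `∃ v ≠ w` above `p`
  in a quadratic field = `p` split; the conclusion `{a, a+g}` has no sign junk (§1,
  `parallel_iff_common_gap`).  No junk model of any interface in the signature was found.
* On paper the crux is a CONSEQUENCE of Fontaine–Mazur–Langlands for `GL₂` over imaginary quadratic
  fields: a cuspidal `π` matching a non-parallel `ρ` cannot exist (Harder / Borel–Wallach vanishing of
  cuspidal cohomology in non-parallel weight; Calegari arXiv:0907.3427 p. 2, before Thm 1.4, proves the
  ORDINARY big-image case `m = n`; Calegari–Mazur arXiv:0708.2451 p. 3: "cuspidal cohomology of GL(2)/K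
  vanishes for non-parallel weights").  A counterexample = an irreducible regular crystalline `ρ` over an
  imaginary quadratic field violating Fontaine–Mazur.  None is known; none is constructible here.
* Every WEAKENING that is false on paper (§3) needs a Galois representation with PLACE-DEPENDENT
  Hodge–Tate data (Hilbert modular `ρ_f` of weight (2,4); sums of CM Hecke characters of type (1,3)).
  The tree's computable Hodge–Tate repertoire (powers of `ε`, unramified, finite image) gives EQUAL
  weights at `v` and `v̄`, so no such witness is constructible: the `_false_without_` theorems of §3 are
  PAPER theorems, recorded with `sorry` and the witness in the docstring (near-miss protocol).

## What IS proved here (sorry-free) and landed under `Theorems/TwistedInductionParallel/Negative/`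

* §0 `twistedInductionParallel_iff` — the crux is literally `HasTwoWeights → GoodRegime → SameParity →
  Parallel` (the line's packages are verbatim sub-formulas).
* §1 `parallel_iff_common_gap` — the conclusion is exactly "all gaps equal" (no `g < 0` junk).
* §2 HYPOTHESIS REDUNDANCY (load-bearing analysis, kernel-checked):
  `isIrreducible_of_isResiduallyAbsIrreducible_restrictField` (ρ̄|F(ζ_p) abs. irreducible ⇒ ρ
  irreducible) and `twistedInductionParallel_iff_withoutIrreducible_withoutDeRham`: the binders
  `ρ.toGaloisRep.IsIrreducible` and the `IsDeRhamFramed` conjunct are IMPLIED by `GoodRegime`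
  (crystalline ⇒ de Rham).  So `hirr`, `IsDeRham` are NOT load-bearing; what carries the crux is:
  imaginary quadratic, crystalline with two distinct weights, residual abs. irreducibility, parity.
* §4 LEVER ARITHMETIC (the line `symmetrise-pd-split`): `exists_concentric_shift_iff` (SameParity is
  NECESSARY AND SUFFICIENT for the determinant of a twist to have equal weights at `w ∣ v`, `w' ∣ v̄`),
  `concentric_nodup_iff_ne` (the induced 4-weight multiset is regular iff the gaps DIFFER — the
  NonRegularWeightBarrier in numbers: parallel ⇒ maximally irregular), and the kernel of the F-level
  twist obstruction `no_symmetrising_pair_of_two_torsion` + `quadraticChar_ne_sq` (ℓ ≡ 3 mod 4: the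
  quadratic character of `𝔽_ℓ` is not a square) — the reason stub 1 must allow a real quadratic `K`.

## Line `symmetrise-pd-split` (stubs 1–4): attacked, all stand ON PAPER (§5, prose)

stub 1 true by CFT (obstruction dies over `E = F·K`; sign fix and crystallinity-of-χ fix both
available); stub 2 in print for gap ≤ p, OPEN beyond (= PD2(ℚ_p)); stub 3 consistent with BLGGT Thm C
as PRINTED (arXiv:1010.2561 p. 4: "GSp_n with totally odd multiplier"; p. 17: ε_v = 1, μ(c_v) = −ε_v
for GSp) — `Ind_E^K(ρ|_E ⊗ χ)` is alternating with multiplier `θ`, so `θ` totally odd is exactly right;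
stub 4 true by AHTW + Clozel purity.  Joint sufficiency is kernel-checked in the skeleton.
No stub is refutable in Lean for the same constructibility reason as the crux.
-/

noncomputable section

open scoped NumberField
open NumberField IsDedekindDomain Field Filter
open Literature.NumberTheory.GaloisRepresentations Literature.NumberTheory.PAdicHodge

-- `Summit.Langlands.Langlands.…` repeats a namespace component by design (D-0017 nested layout).
set_option linter.dupNamespace false

namespace Summit.Langlands.Langlands.Cruxes.TwistedInductionParallel.Disproof

/-! ## §0  Probe and packages (verbatim sub-formulas of the route decl) -/

section Packages

variable (F : Type) [Field F] [NumberField F] (p : ℕ) [Fact p.Prime]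
  (ρ : FramedGaloisRep F (PadicAlgCl p) 2)

/-- The crux's `p`-adic Hodge hypothesis (de Rham at every `v ∣ p`, two distinct labelled weights at
every label).  Verbatim sub-formula of `TwistedInductionParallel`. [folklore] -/
def HasTwoWeights : Prop :=
  ∀ (v : HeightOneSpectrum (𝓞 F)) (hv : ((p : ℕ) : 𝓞 F) ∈ v.asIdeal),
    (fontainePstAdicCompletion v p hv).IsDeRhamFramed (ρ.toLocal v) ∧
    (letI := (fontainePstAdicCompletion v p hv).algebra
     ∀ τ : v.adicCompletion F →ₐ[ℚ_[p]] PadicAlgCl p, ∃ a b : ℤ, a < b ∧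
      ρ.labelledHodgeTateWeightsAt v (fontainePstAdicCompletion v p hv).algebra
        (fontainePstAdicCompletion v p hv).𝔅 τ.toRingHom = {a, b})

/-- `HasTwoWeights` with the de Rham conjunct DELETED (it is implied by crystallinity, §2). [folklore] -/
def HasTwoWeights' : Prop :=
  ∀ (v : HeightOneSpectrum (𝓞 F)) (hv : ((p : ℕ) : 𝓞 F) ∈ v.asIdeal),
    letI := (fontainePstAdicCompletion v p hv).algebra
    ∀ τ : v.adicCompletion F →ₐ[ℚ_[p]] PadicAlgCl p, ∃ a b : ℤ, a < b ∧
      ρ.labelledHodgeTateWeightsAt v (fontainePstAdicCompletion v p hv).algebra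
        (fontainePstAdicCompletion v p hv).𝔅 τ.toRingHom = {a, b}

/-- The crux's good regime (`p ≥ 11`, split, crystalline at every `v ∣ p`, `ρ̄|F(ζ_p)` absolutely
irreducible).  Verbatim sub-formula of `TwistedInductionParallel`. [folklore] -/
def GoodRegime : Prop :=
  11 ≤ p ∧
  (∃ v w : HeightOneSpectrum (𝓞 F), v ≠ w ∧ ((p : ℕ) : 𝓞 F) ∈ v.asIdeal ∧ ((p : ℕ) : 𝓞 F) ∈ w.asIdeal) ∧
  (∀ (v : HeightOneSpectrum (𝓞 F)) (hv : ((p : ℕ) : 𝓞 F) ∈ v.asIdeal),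
    (fontainePstAdicCompletion v p hv).IsCrystallineFramed (ρ.toLocal v)) ∧
  FramedGaloisRep.IsResiduallyAbsIrreducible (ρ.restrictField (CyclotomicField p F))

/-- The crux's parity hypothesis (any two labelled gaps have even sum).  Verbatim. [folklore] -/
def SameParity : Prop :=
  ∀ (v : HeightOneSpectrum (𝓞 F)) (hv : ((p : ℕ) : 𝓞 F) ∈ v.asIdeal)
    (w : HeightOneSpectrum (𝓞 F)) (hw : ((p : ℕ) : 𝓞 F) ∈ w.asIdeal),
    letI := (fontainePstAdicCompletion v p hv).algebra
    letI := (fontainePstAdicCompletion w p hw).algebra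
    ∀ (τ : v.adicCompletion F →ₐ[ℚ_[p]] PadicAlgCl p) (σ : w.adicCompletion F →ₐ[ℚ_[p]] PadicAlgCl p)
      (a b a' b' : ℤ),
      ρ.labelledHodgeTateWeightsAt v (fontainePstAdicCompletion v p hv).algebra
          (fontainePstAdicCompletion v p hv).𝔅 τ.toRingHom = {a, b} → a < b →
      ρ.labelledHodgeTateWeightsAt w (fontainePstAdicCompletion w p hw).algebra
          (fontainePstAdicCompletion w p hw).𝔅 σ.toRingHom = {a', b'} → a' < b' →
      Even (b - a + (b' - a'))

/-- The crux's conclusion (one `g` for all labels).  Verbatim. [folklore] -/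
def Parallel : Prop :=
  ∃ g : ℤ, ∀ (v : HeightOneSpectrum (𝓞 F)) (hv : ((p : ℕ) : 𝓞 F) ∈ v.asIdeal),
    letI := (fontainePstAdicCompletion v p hv).algebra
    ∀ τ : v.adicCompletion F →ₐ[ℚ_[p]] PadicAlgCl p, ∃ a : ℤ,
      ρ.labelledHodgeTateWeightsAt v (fontainePstAdicCompletion v p hv).algebra
        (fontainePstAdicCompletion v p hv).𝔅 τ.toRingHom = {a, a + g}

/-- "All gaps are equal to one `g`" — the intended reading of the conclusion. [folklore] -/
def CommonGap : Prop :=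
  ∃ g : ℤ, ∀ (v : HeightOneSpectrum (𝓞 F)) (hv : ((p : ℕ) : 𝓞 F) ∈ v.asIdeal),
    letI := (fontainePstAdicCompletion v p hv).algebra
    ∀ (τ : v.adicCompletion F →ₐ[ℚ_[p]] PadicAlgCl p) (a b : ℤ),
      ρ.labelledHodgeTateWeightsAt v (fontainePstAdicCompletion v p hv).algebra
        (fontainePstAdicCompletion v p hv).𝔅 τ.toRingHom = {a, b} → a < b → b - a = g

end Packages

/-- **Probe / unfolding.** The crux IS `irreducible → a.e. unramified → HasTwoWeights → GoodRegime →
SameParity → Parallel`, definitionally (the line's packages are verbatim). [folklore] -/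
theorem twistedInductionParallel_iff :
    Summit.Langlands.Langlands.Theses.NonParallelVoid.TwistedInductionParallel ↔
      ∀ (F : Type) [Field F] [NumberField F] [Algebra.IsQuadraticExtension ℚ F],
        NumberField.IsTotallyComplex F → ∀ (p : ℕ) [Fact p.Prime]
        (ρ : FramedGaloisRep F (PadicAlgCl p) 2),
        ρ.toGaloisRep.IsIrreducible →
        (∀ᶠ v : HeightOneSpectrum (𝓞 F) in cofinite, ρ.IsUnramifiedAt v) →
        HasTwoWeights F p ρ → GoodRegime F p ρ → SameParity F p ρ → Parallel F p ρ :=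
  Iff.rfl

/-! ## §1  The conclusion has no junk: `Parallel ↔ CommonGap` under `HasTwoWeights'` -/

/-- Two-element multisets: `{a, b} = {c, d} ↔ (a = c ∧ b = d) ∨ (a = d ∧ b = c)`. [folklore] -/
theorem pair_eq_pair_iff {α : Type*} [DecidableEq α] (a b c d : α) :
    ({a, b} : Multiset α) = {c, d} ↔ (a = c ∧ b = d) ∨ (a = d ∧ b = c) := by
  simp only [Multiset.insert_eq_cons, Multiset.cons_eq_cons, Multiset.singleton_inj,
    Multiset.singleton_eq_cons_iff, ne_eq]
  constructor
  · rintro (⟨rfl, rfl⟩ | ⟨-, cs, ⟨rfl, rfl⟩, rfl, -⟩)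
    · exact Or.inl ⟨rfl, rfl⟩
    · exact Or.inr ⟨rfl, rfl⟩
  · rintro (⟨rfl, rfl⟩ | ⟨rfl, rfl⟩)
    · exact Or.inl ⟨rfl, rfl⟩
    · by_cases h : a = b
      · exact Or.inl ⟨h, h.symm⟩
      · exact Or.inr ⟨h, 0, ⟨rfl, rfl⟩, rfl, rfl⟩

/-- **The conclusion `∃ g, ∀ labels, ∃ a, HT = {a, a + g}` is EXACTLY "one common gap"** for a `ρ`
with two distinct weights at every label: a negative `g` realises the gap `−g` at every label at once,
so nothing is lost or smuggled by the `{a, a + g}` phrasing. [folklore] -/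
theorem parallel_iff_commonGap {F : Type} [Field F] [NumberField F] {p : ℕ} [Fact p.Prime]
    {ρ : FramedGaloisRep F (PadicAlgCl p) 2} (hHT : HasTwoWeights' F p ρ) :
    Parallel F p ρ ↔ CommonGap F p ρ := by
  classical
  constructor
  · rintro ⟨g, hg⟩
    refine ⟨|g|, fun v hv τ a b hab hlt => ?_⟩
    obtain ⟨a₀, h₀⟩ := hg v hv τ
    rw [hab] at h₀
    rcases (pair_eq_pair_iff a b a₀ (a₀ + g)).1 h₀ with ⟨rfl, rfl⟩ | ⟨rfl, rfl⟩
    · rw [abs_of_pos (by omega)]; omega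
    · rw [abs_of_neg (by omega)]; omega
  · rintro ⟨g, hg⟩
    refine ⟨g, fun v hv τ => ?_⟩
    obtain ⟨a, b, hlt, hab⟩ := hHT v hv τ
    refine ⟨a, ?_⟩
    rw [hab, show a + g = b from by have := hg v hv τ a b hab hlt; omega]

/-! ## §2  Load-bearing analysis, kernel-checked part: `hirr` and `IsDeRham` are REDUNDANT -/

/-- **`ρ̄|Γ_L` absolutely irreducible ⇒ `ρ` irreducible** (any extension `L/F`, rank `2`, `ℚ̄_p`
coefficients): Burnside bridge `IsResiduallyAbsIrreducible.isAbsolutelyIrreducible` for `ρ|_{Γ_L}`,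
then an irreducible restriction forces irreducibility (`isIrreducible_of_isIrreducible_comp`).  Hence
the binder `ρ.toGaloisRep.IsIrreducible` of the crux is implied by the last conjunct of its good
regime. (Darmon–Diamond–Taylor 1995 §2.1; Curtis–Reiner (27.4).) -/
theorem isIrreducible_of_isResiduallyAbsIrreducible_restrictField {F : Type} [Field F] {p : ℕ}
    [Fact p.Prime] (L : Type*) [Field L] [Algebra F L] (ρ : FramedGaloisRep F (PadicAlgCl p) 2)
    (h : FramedGaloisRep.IsResiduallyAbsIrreducible (ρ.restrictField L)) :
    ρ.toGaloisRep.IsIrreducible := by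
  have habs := FramedGaloisRep.IsResiduallyAbsIrreducible.isAbsolutelyIrreducible two_pos h
  have hirrL : FramedRep.IsIrreducible (ρ.restrictField L) := habs.isIrreducible
  exact Literature.RepresentationTheory.Semisimple.Representation.isIrreducible_of_isIrreducible_comp
    (FramedRep.toRepresentation ρ) (absGaloisRestrict F L).toMonoidHom hirrL

/-- **Crystalline ⇒ de Rham** for the pinned datum (structure axiom of `PstWeilDeligneData`), so the
`IsDeRhamFramed` conjunct of the Hodge hypothesis is implied by the good regime. [folklore] -/
theorem hasTwoWeights_of_goodRegime {F : Type} [Field F] [NumberField F] {p : ℕ} [Fact p.Prime]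
    {ρ : FramedGaloisRep F (PadicAlgCl p) 2} (hG : GoodRegime F p ρ) (hHT : HasTwoWeights' F p ρ) :
    HasTwoWeights F p ρ :=
  fun v hv => ⟨(hG.2.2.1 v hv).isDeRhamFramed, hHT v hv⟩

/-- The crux with the binder `ρ.toGaloisRep.IsIrreducible →` AND the de Rham conjunct DELETED. [folklore] -/
def TwistedInductionParallelWithoutIrreducibleWithoutDeRham : Prop :=
  ∀ (F : Type) [Field F] [NumberField F] [Algebra.IsQuadraticExtension ℚ F],
    NumberField.IsTotallyComplex F → ∀ (p : ℕ) [Fact p.Prime]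
    (ρ : FramedGaloisRep F (PadicAlgCl p) 2),
    (∀ᶠ v : HeightOneSpectrum (𝓞 F) in cofinite, ρ.IsUnramifiedAt v) →
    HasTwoWeights' F p ρ → GoodRegime F p ρ → SameParity F p ρ → Parallel F p ρ

/-- **`hirr` and `IsDeRham` are not load-bearing**: the crux is EQUIVALENT to the statement with both
deleted.  (So no proof can use irreducibility of `ρ` "essentially": it is one line from
`GoodRegime`; and de Rham-ness is free from crystallinity.)  What remains load-bearing: imaginary
quadratic base, crystalline with two distinct weights, `ρ̄|F(ζ_p)` abs. irreducible, parity, and —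
for the LEVER only — `p ≥ 11` split. [folklore] -/
theorem twistedInductionParallel_iff_withoutIrreducible_withoutDeRham :
    Summit.Langlands.Langlands.Theses.NonParallelVoid.TwistedInductionParallel ↔
      TwistedInductionParallelWithoutIrreducibleWithoutDeRham := by
  constructor
  · intro h F _ _ _ hF p _ ρ hunr hHT hG hE
    exact h F hF p ρ (isIrreducible_of_isResiduallyAbsIrreducible_restrictField _ ρ hG.2.2.2) hunr
      (hasTwoWeights_of_goodRegime hG hHT) hG hE
  · intro h F _ _ _ hF p _ ρ _ hunr hHT hG hE
    exact h F hF p ρ hunr (fun v hv => (hHT v hv).2) hG hE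

/-! ## §3  Load-bearing analysis, PAPER part (witnesses not constructible in the tree)

Each `…Without<H>` below is the crux with ONE hypothesis dropped; each `_false_without_` is a theorem
of the literature whose witness is a Galois representation with place-dependent Hodge–Tate data —
not constructible here (no CM/Lubin–Tate characters, no `ρ_f` for Hilbert or Bianchi forms, no
class field theory).  They are recorded as near-misses (`sorry`, work file only).  Hypotheses NOT
listed (`11 ≤ p`, `p` split, crystalline-vs-de-Rham, `ρ̄|F(ζ_p)` abs. irreducible, `SameParity`) are
load-bearing for the LEVER but conjecturally NOT for truth: the full parallel-weight statement
(route `Target`) is expected for every irreducible geometric regular `ρ` (Calegari 2009 p. 2). -/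

/-- The crux with `NumberField.IsTotallyComplex F` dropped (so `F` may be REAL quadratic). [folklore] -/
def TwistedInductionParallelWithoutTotallyComplex : Prop :=
  ∀ (F : Type) [Field F] [NumberField F] [Algebra.IsQuadraticExtension ℚ F] (p : ℕ) [Fact p.Prime]
    (ρ : FramedGaloisRep F (PadicAlgCl p) 2),
    ρ.toGaloisRep.IsIrreducible →
    (∀ᶠ v : HeightOneSpectrum (𝓞 F) in cofinite, ρ.IsUnramifiedAt v) →
    HasTwoWeights F p ρ → GoodRegime F p ρ → SameParity F p ρ → Parallel F p ρ

/-- **PAPER THEOREM (near-miss, not closable here).**  `IsTotallyComplex F` is load-bearing: over a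
REAL quadratic `F` (e.g. `ℚ(√5)`) take a non-CM Hilbert newform `f` of NON-PARALLEL weight
`(k₁, k₂) = (2, 4)` (exists at suitable level; `k₁ ≡ k₂ (mod 2)`), `p ≥ 11` split in `F`, `p ∤` level,
and `ρ = ρ_{f,𝔭}` (Carayol, Taylor, Blasius–Rogawski): irreducible, a.e. unramified, crystalline at
both `v ∣ p` with labelled weights `{0, 1}` at one place and `{0, 3}` at the other (up to the shift
`(k₂ − k₁)/2` conventions: gaps `k₁ − 1 = 1 ≠ 3 = k₂ − 1`, gap sum `4` even), and for `p` large
`ρ̄` has image `⊇ SL₂(𝔽_p)` (Dimitrov 2005), so `ρ̄|F(ζ_p)` is absolutely irreducible: every hypothesis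
holds and `Parallel` fails.  OBSTRUCTION: no `ρ_f` (indeed no Galois representation whose labelled
weights differ between two places above `p`) is constructible in the tree; tried: the tree's
computable weights (`CyclotomicPowersLabelledWeights`, `UnramifiedWeightsZero`, finite image) are the
SAME at `v` and `v̄`. [cite: BarnetlambEtAl2014, Introduction (Notation)] -/
theorem twistedInductionParallel_false_without_totallyComplex :
    ¬ TwistedInductionParallelWithoutTotallyComplex := by
  sorry

/-- The crux with `Algebra.IsQuadraticExtension ℚ F` dropped (any totally complex `F`). [folklore] -/
def TwistedInductionParallelWithoutQuadratic : Prop :=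
  ∀ (F : Type) [Field F] [NumberField F], NumberField.IsTotallyComplex F → ∀ (p : ℕ) [Fact p.Prime]
    (ρ : FramedGaloisRep F (PadicAlgCl p) 2),
    ρ.toGaloisRep.IsIrreducible →
    (∀ᶠ v : HeightOneSpectrum (𝓞 F) in cofinite, ρ.IsUnramifiedAt v) →
    HasTwoWeights F p ρ → GoodRegime F p ρ → SameParity F p ρ → Parallel F p ρ

/-- **PAPER THEOREM (near-miss).**  The degree-`2` hypothesis is load-bearing: for the quartic CM field
`F = F⁺·ℚ(√−1)`, `F⁺ = ℚ(√5)`, and `ρ = ρ_{f,𝔭}|Γ_F` (base change of the weight-`(2,4)` Hilbert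
representation of the previous docstring; `p` totally split in `F`), `ρ` stays irreducible with big
residual image (index `2`), is crystalline at the four places above `p` with weights `{0,1},{0,1},
{0,3},{0,3}` (restriction invariance of labelled weights), gap sums even, and is NOT parallel.
Clozel purity only equates the gaps at COMPLEX-CONJUGATE labels, which over an imaginary QUADRATIC
field are the only two labels — that is the whole point of the degree-`2` restriction.  OBSTRUCTION: as
above (no `ρ_f`). [cite: Clozel1990, Lemme 4.9] -/
theorem twistedInductionParallel_false_without_quadratic :
    ¬ TwistedInductionParallelWithoutQuadratic := by
  sorry

/-- The crux with BOTH irreducibility hypotheses dropped (`hirr` and the residual clause of the good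
regime; dropping `hirr` alone changes nothing by §2). [folklore] -/
def TwistedInductionParallelWithoutAnyIrreducibility : Prop :=
  ∀ (F : Type) [Field F] [NumberField F] [Algebra.IsQuadraticExtension ℚ F],
    NumberField.IsTotallyComplex F → ∀ (p : ℕ) [Fact p.Prime]
    (ρ : FramedGaloisRep F (PadicAlgCl p) 2),
    (∀ᶠ v : HeightOneSpectrum (𝓞 F) in cofinite, ρ.IsUnramifiedAt v) →
    HasTwoWeights F p ρ →
    (11 ≤ p ∧
      (∃ v w : HeightOneSpectrum (𝓞 F), v ≠ w ∧ ((p : ℕ) : 𝓞 F) ∈ v.asIdeal ∧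
        ((p : ℕ) : 𝓞 F) ∈ w.asIdeal) ∧
      (∀ (v : HeightOneSpectrum (𝓞 F)) (hv : ((p : ℕ) : 𝓞 F) ∈ v.asIdeal),
        (fontainePstAdicCompletion v p hv).IsCrystallineFramed (ρ.toLocal v))) →
    SameParity F p ρ → Parallel F p ρ

/-- **PAPER THEOREM (near-miss).**  Irreducibility (in its one effective form, the residual clause) is
load-bearing: over `F = ℚ(i)`, `p ≡ 1 (mod 4)`, `p ≥ 13`, let `ψ` be the `p`-adic avatar of an
algebraic Hecke character of `F` of infinity type `z ↦ z^1 z̄^3` and conductor prime to `p` (exists: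
`|𝒪_F^×| = 4` is killed by any conductor `𝔣` with `(𝒪/𝔣)^× ⊋ μ₄` faithfully), and `ρ = 1 ⊕ ψ`:
a.e. unramified, crystalline at `v, v̄` with labelled weights `{0, −1}` and `{0, −3}` (gaps `1 ≠ 3`,
sum even), reducible.  OBSTRUCTION: no CM/Hecke-character Galois avatar with unequal weights at `v`
and `v̄` is constructible (class field theory absent); the tree's `exists_heckeCharacter_of_isDeRhamFramed`
goes the other way and is itself a named fact. [cite: SerreAbelianLadic1968, Ch. III §1.1] -/
theorem twistedInductionParallel_false_without_anyIrreducibility :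
    ¬ TwistedInductionParallelWithoutAnyIrreducibility := by
  sorry

/-! ## §4  Lever arithmetic (line `symmetrise-pd-split`): what SameParity and NonParallel buy, exactly

Stub 1 (`stub_symmetrisingTwist`) needs `det(ρ|_E ⊗ χ) = θ|_E`; at the two places `w ∣ v`, `w' ∣ v̄`
of `E` over one place `u` of `K` this says, on labelled Hodge–Tate weights, `(a+b) + 2k = t = (a'+b') + 2l`
(`k, l` the weights of `χ` at `w, w'`, `t` that of `θ` at `u`).  Stub 3 needs `Ind_E^K(ρ|_E ⊗ χ)` to be
Hodge–Tate REGULAR at `u`: the multiset `{a+k, b+k, a'+l, b'+l}` has no repeats. -/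

/-- **SameParity is NECESSARY AND SUFFICIENT for the symmetrising shift**: integers `k, l` with
`(a+b)+2k = (a'+b')+2l` exist iff the gap sum `(b−a)+(b'−a')` is even.  (So without `SameParity` the
determinant of NO twist `ρ|_E ⊗ χ` descends to `K` with `χ` Hodge–Tate: the odd-gap-difference sector is
the sibling cruxes `TensorSquareParallel`/`EmptyWeightCore`, not a strengthening of this one.) [folklore] -/
theorem exists_concentric_shift_iff (a b a' b' : ℤ) :
    (∃ k l : ℤ, a + b + 2 * k = a' + b' + 2 * l) ↔ Even (b - a + (b' - a')) := by
  simp only [Int.even_iff]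
  constructor
  · rintro ⟨k, l, h⟩
    omega
  · intro h
    exact ⟨(a' + b' - (a + b)) / 2, 0, by omega⟩

/-- **Regular iff non-parallel** (given the descended determinant): for `a < b`, `a' < b'` and
`(a+b)+2k = (a'+b')+2l`, the four induced weights `{a+k, b+k, a'+l, b'+l}` are pairwise distinct iff the
gaps differ.  This is the "parity–regularity coincidence" of the route header as a checked identity, and
the NonRegularWeightBarrier in numbers: PARALLEL `ρ` make the induction maximally irregular (the two
pairs coincide, `concentric_pairs_eq_of_parallel`). [folklore] -/
theorem concentric_nodup_iff_ne (a b a' b' k l : ℤ) (hab : a < b) (hab' : a' < b')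
    (hdet : a + b + 2 * k = a' + b' + 2 * l) :
    ({a + k, b + k, a' + l, b' + l} : Multiset ℤ).Nodup ↔ b - a ≠ b' - a' := by
  simp only [Multiset.insert_eq_cons, Multiset.nodup_cons, Multiset.mem_cons,
    Multiset.mem_singleton, Multiset.nodup_singleton, and_true, not_or]
  omega

/-- Parallel gaps ⇒ the two concentric pairs COINCIDE (complement of `concentric_nodup_iff_ne`). [folklore] -/
theorem concentric_pairs_eq_of_parallel (a b a' b' k l : ℤ)
    (hdet : a + b + 2 * k = a' + b' + 2 * l) (hgap : b - a = b' - a') :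
    a + k = a' + l ∧ b + k = b' + l := by
  omega

/-- **Kernel of the F-level twist obstruction (why stub 1 needs `K ≠ ℚ`).**  In any abelian groups: if
`ψ = (θ ∘ N) · χ²` then `ψ` is trivial on every `2`-torsion element of `ker N`.  Applied with
`G = G_F^ab`, `N` = transfer to `G_ℚ^ab`, `ψ = det ρ`, `t = s_v · s_v̄` (local `−1`'s at the two places
over a split `ℓ`): `N t = s_ℓ² = 1`, `t² = 1`, but `det ρ (t) = (det ρ)_v(−1)·(det ρ)_v̄(−1) = −1` when
`det ρ|I_v` is the quadratic character of `ℤ_ℓ^×` (`ℓ ≡ 3 mod 4`, `quadraticChar_neg_one_of_mod_four`)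
and `det ρ|I_v̄` is even — so no `θ, χ` exist over `F`. [folklore] -/
theorem no_symmetrising_pair_of_two_torsion {G G' C : Type*} [CommGroup G] [CommGroup G']
    [CommGroup C] (N : G →* G') (ψ : G →* C) {t : G} (ht : t * t = 1) (hN : N t = 1)
    (hψ : ψ t ≠ 1) : ¬ ∃ (θ : G' →* C) (χ : G →* C), ∀ g, ψ g = θ (N g) * χ g ^ 2 := by
  rintro ⟨θ, χ, h⟩
  apply hψ
  rw [h t, hN, map_one, one_mul, sq, ← map_mul, ht, map_one]

/-- The quadratic character of `𝔽_ℓ`, `ℓ ≡ 3 (mod 4)`, takes the value `−1` at `−1`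
(Mathlib: `quadraticChar_neg_one`, `ZMod.χ₄_nat_three_mod_four`). [folklore] -/
theorem quadraticChar_neg_one_of_mod_four {ℓ : ℕ} [Fact ℓ.Prime] (hℓ : ℓ % 4 = 3) :
    quadraticChar (ZMod ℓ) (-1) = -1 := by
  have h2 : ringChar (ZMod ℓ) ≠ 2 := by
    rw [ZMod.ringChar_zmod_n]
    omega
  rw [quadraticChar_neg_one h2, ZMod.card ℓ]
  exact ZMod.χ₄_nat_three_mod_four hℓ

/-- **The quadratic character of `𝔽_ℓ` (`ℓ ≡ 3 mod 4`) is not the square of any multiplicative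
character** (evaluate at `−1`: a square takes the value `χ(−1)² = χ(1) = 1 ≠ −1`).  This is the LOCAL
shadow of the obstruction: at a split `ℓ ≡ 3 (4)` the inertial restriction of `det ρ` can be this
character at `v` and trivial at `v̄`, and then `det ρ · χ²` is never `Gal(F/ℚ)`-invariant. [folklore] -/
theorem quadraticChar_ne_sq {ℓ : ℕ} [Fact ℓ.Prime] (hℓ : ℓ % 4 = 3) (χ : MulChar (ZMod ℓ) ℤ) :
    χ * χ ≠ quadraticChar (ZMod ℓ) := by
  intro h
  have h1 : (χ * χ) (-1) = 1 := by
    rw [MulChar.mul_apply, ← map_mul, neg_mul_neg, one_mul, map_one]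
  rw [h, quadraticChar_neg_one_of_mod_four hℓ] at h1
  exact absurd h1 (by decide)

/-! ## §5  Line `symmetrise-pd-split`: stub-by-stub attack (prose; nothing refutable)

* `stub_symmetrisingTwist` — TRUE ON PAPER.  Re-derived independently: obstruction group
  `X_E/(res X_K + 2X_E)`; `ψ ∈ 2X_E ⇔ ψ|_{G_E^ab[2]} = 1` (Pontryagin, `p` odd); for `E` totally
  imaginary `G_E^ab = 𝔸_{E,f}^×/closure(E^×U_E)` and `G_E^ab[2]` is generated by local sign ideles `s_w`
  (squares satisfy local–global, `n = 2` is never a Grunwald–Wang exception; roots of unity lie in `E^×`);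
  `Ψ = det ρ|_E/θ|_E` on `s_w` is `(det ρ)_v((−1)^{[E_w:F_v]})·θ_u((−1)^{[E_w:K_u]})⁻¹`, killed by
  choosing `K = ℚ(√d)` with `[E_w:F_v] = 2` at the bad `v` and `θ_u(−1) = +1` at every finite `u`
  split in `E/K`.  EXTRA WRINKLES found (information for the prover, none fatal):
  (i) at `u ∣ p` (split in `E`) the condition reads `θ_u(−1) = (det ρ)_v(−1) = (−1)^{a+b}`, which is
  AUTOMATIC for the crystalline `θ_u` of weight `t = a+b+2k` (clause (F12) `CrystallineDetOnInertia` is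
  exactly the fact used); (ii) TOTAL ODDNESS of `θ` is compatible with the finite local conditions:
  triviality on the global unit `−1` forces `∏_{u finite} θ_u(−1) = +1`, met by ramifying `θ` at ONE
  auxiliary place `u₀` inert in `E/K` with `N u₀ ≡ 3 (4)` (Chebotarev in `E·K(i)/K`; when `E = K(i)`,
  e.g. `F = ℚ(i)`, "inert in `E`" already means `N u₀ ≡ 3 (4)`); the fundamental unit is handled at a
  second auxiliary place; (iii) CRYSTALLINITY OF `χ` above `p`: a square root of the crystalline
  character `det ρ|_E θ⁻¹|_E` is crystalline up to a quadratic character possibly RAMIFIED at `w ∣ p`;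
  fix it by `χ ↦ χν`, `ν` a global quadratic character with prescribed components at the places above
  `p` (Grunwald–Wang, `n = 2`), which keeps `det(ρ|_E ⊗ χν) = θ|_E`; (iv) condition (d): by Mackey,
  `Ind_E^K(W̄)|K(ζ_p)` is irreducible iff `ρ̄|E(ζ_p)` is irreducible (choose `K` disjoint from the field
  of `ρ̄|F(ζ_p)`; note `K = ℚ(√(±Dp))` would put `E` inside `K(ζ_p)` — avoid) and `W̄^c̃ ≇ W̄`, arranged
  by one auxiliary ramified prime in `χ̄`.  TYPE-LEVEL: `SymmetrisingTwistDatum` does not record that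
  `p` splits in `K`; harmless — regularity (iv of stub 3) holds label by label for `K_u = ℚ_{p²}` as
  well (both pairs over a label `τ_i` of `K_u` are concentric about `t_i/2`).  PROVABILITY RISK (not
  falsity): `IsAlgebraicAbove p E χ` asks `IsCrystallineFramed` of the PINNED datum's Weil–Deligne half
  for a product `ε^k · (finite unramified) · …`; among the clauses (F1)–(F12) only (F4) (ε) and (F8)
  (unramified) speak to it — ⊗-stability of pinned crystallinity is NOT a clause.  The available route
  is the named fact `GeeGeraghty2012.crystalline_of_ordinary_regular` (file
  `PAdicHodge/CrystallineOfOrdinaryRegular`, rank `n = 1`: a character equal ON ALL OF INERTIA to the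
  algebraic character `∏_τ τ(Art⁻¹ ·)^{-λ_τ}` is crystalline for THE pinned datum, relative to a CANONICAL
  `LocalArtinData`) — so stub 1's `χ` should be produced with its inertial restriction at `w ∣ p` exactly
  algebraic (which the Grunwald–Wang adjustment (iii) arranges).
* `stub_pdAtSplitPrime` — in print for gap `≤ p` (Bartlett 2020, Gao–Liu 2014; ordinary case PROVED in
  tree), OPEN beyond; `∀ 𝔈 : PstCrystallineExtensionData` ranges over an interface but
  `isPotentiallyDiagonalizable_one` / `…_of_hasInvariantCompleteFlag` hold for EVERY `𝔈`, and PD is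
  typed through connecting families (faithful, `PotentialDiagonalizability.lean`): no junk-`𝔈` kill.
* `stub_potentialAutomorphyOfTwist` — consistent with BLGGT Thm C AS PRINTED (arXiv:1010.2561 p. 4,
  "Either r maps to GSp_n with totally odd multiplier or it maps to GO(n) with totally even
  multiplier"; p. 17: GSp ⇔ μ(c_v) = −ε_v, totally odd ⇔ ε_v = 1): on `I = W ⊕ c̃W` the pairing
  `x₁∧y₁ + θ(c̃)·x₂∧y₂` is alternating with multiplier `θ` (check: `⟨c̃x, c̃y⟩ = θ(c̃²)x₂∧y₂ + θ(c̃)x₁∧y₁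
  = θ(c̃)⟨x,y⟩`), so `θ` TOTALLY ODD is exactly the printed hypothesis; `p ≥ 11 ≥ 2(4+1)`; regularity =
  `concentric_nodup_iff_ne`; a.e.-unramifiedness of `χ` is automatic for continuous `p`-adic CHARACTERS
  (inertia images of `∏_w 𝒪_w^×` in a `p`-adic Lie group of rank ≤ [E':ℚ_p] kill all but finitely many
  factors), so the datum need not record it.
* `stub_parallelOfAutomorphicTwist` — TRUE ON PAPER (AHTW Thm 1.2.1 + Clozel purity + restriction
  invariance); does not need irreducibility (cuspidality of `π₂` is in `IsAutomorphic`).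
* Joint sufficiency: `TwistedInductionParallel_of` is kernel-checked in the skeleton; no gap.
* `AutomorphicTwistOverCM`/`Qian2022.IsAutomorphic` are NOT junk-inhabitable: `CuspidalAutomorphicRepData`
  needs a non-zero space of CUSP forms (`CuspConditionGL`: `∀` Haar `ν`, `∀` fundamental domain — not
  vacuous, adelic Haar measures exist), and the constant automorphic form fails it for `n = 2`.
-/

end Summit.Langlands.Langlands.Cruxes.TwistedInductionParallel.Disproof
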